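import Literature.NumberTheory.Automorphic.ArchRankOneCasimirLadderCayley          -- ★ p850774 (this seat): (α2) `exists_forall_eventually_norm_iteratedDeriv_orbitalIntegral_cayley_le` (one-place engine, Cayley frame); brings ★ `isCompact_setOf_exists_conj_endoBlock_mem_of_not_mem`
import Literature.NumberTheory.Automorphic.ArchRankOneJumpZeroCone                 -- ★ (LH10-p02 (g3)): `isClosedEmbedding_coe_unitaryGroupOfForm_of_eq_over` (`U(Φ₂)_w ↪ M₂(ℂ)` is closed)
import Literature.NumberTheory.Automorphic.ArchLocalRegularOrbitClosed             -- ★ `locallyCompactSpace_archLocal`, `secondCountableTopology_archLocal`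
import Mathlib.Analysis.Calculus.BumpFunction.FiniteDimension                      -- `ContDiffBump` on a finite-dimensional space (one bump `f₊`)
import HarnessLib

/-!
# HARISH-CHANDRA'S BOUNDEDNESS OF THE NORMALISED ELLIPTIC ORBITAL VOLUME at a compact place of `H_∞`, Cayley frame, UNIFORM IN THE CENTRE
# (`2|sin ψ| · ν_w{g : g · P t_u(ψ) P⁻¹ · g⁻¹ ∈ C} ≤ B` for `0 < |ψ| < δ`, all `u ∈ S¹`; Varadarajan 1989 §6.4 Thm 22, Bouaziz 1994 §3.1 (I₂), Rogawski 1990 §8.2)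

Topic `NumberTheory/Automorphic`; namespace `Literature.NumberTheory.Automorphic.UnitaryGroup`.  THEOREMS ONLY (no `def`, no instance, no axiom, no `sorry`).  Cell `pub/hodgecm-mathlib`,
crux H413 (`stmt-HodgeConjecture-24833`), line LH3 (closer stub `stub_N9`, DIRECT ROAD), organ O-L3′ conjunct (ii) pay-down for GENERAL `fH` (LH3-plan (g3) RULINGS #7 (d) ∕ #11), stage
(α4⁰) part 1∕3: the WALL-PLACE factor of the order-zero (I₂) bound.  Author LH3-p01 (g4).  Count-neutral.

THE MATHEMATICS.  At a compact place `w` the leaf of the unfolded chart orbital integral is the whole group (★ (α1)): the factor to control near a wall point is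
`‖1 − e^{i(θ₂−θ₀)}‖ · ν_w{g : g γ_w(c_w) g⁻¹ ∈ C_w}` with `γ_w(c_w) = P · diag(e^{iθ₀}, e^{iθ₂}) · P⁻¹ = P t_u(ψ) P⁻¹`, `t_u(ψ) = diag(u e^{iψ}, u e^{−iψ})`, `ψ = (θ₀−θ₂)/2 − mπ → 0`,
`u = e^{i((θ₀+θ₂)/2 + mπ)}`, `‖1 − e^{i(θ₂−θ₀)}‖ = 2|sin ψ|`.  The one-place engine ★ (α2) bounds `2 sin ψ · ∫ f(↑↑(g · P t_z(ψ) P⁻¹ · g⁻¹)) dν` near `ψ = 0` for a FIXED centre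
`z`; uniformity in the centre comes from POSITIVITY: `P t_u(ψ) P⁻¹ = u · P t_1(ψ) P⁻¹` as matrices (**`coe_cayleyTorus_eq_smul`**), so for ONE smooth bump `f₊ ≥ 0` equal to `1` on the
circle-saturation `S¹ · C ⊆ M₂(ℂ)` (compact; `U(Φ₂)_w ↪ M₂(ℂ)` is a closed embedding), `1_{{g : g P t_u(ψ) P⁻¹ g⁻¹ ∈ C}} ≤ f₊(↑↑(g · P t_1(ψ) P⁻¹ · g⁻¹))` for EVERY `u`, whence
**`exists_two_mul_abs_sin_mul_measure_conj_mem_le`**: `∃ δ > 0, ∃ B, ∀ u ψ, ψ ≠ 0 → |ψ| < δ → ν{…} < ∞ ∧ 2|sin ψ| · ν{g : g · P t_u(ψ) P⁻¹ · g⁻¹ ∈ C} ≤ B` (the conjugating set of a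
regular point is compact, ★ `isCompact_setOf_exists_conj_endoBlock_mem_of_not_mem`).  In coordinates (**`exists_nhds_norm_mul_measure_conj_endoBlock_mem_le`**): at `w ∉ S` and a base
point `c₀` ON the wall, `∃ U ∈ 𝓝 c₀, ∃ B, ∀ c ∈ U` regular at `w`, `ν{g : g γ_w(c) g⁻¹ ∈ C} < ∞ ∧ ‖1 − e^{i(c_w2 − c_w0)}‖ · ν{g : g γ_w(c) g⁻¹ ∈ C} ≤ B`.
HONEST LABEL: HC_CM is proved only modulo the 7 printed citations (2 remaining: hLiu418 = stmt-HodgeConjecture-24832, h413 = stmt-HodgeConjecture-24833) until rung 0 closes;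
one-place estimate, consumed by the product-positivity assembly (α4⁰) parts 2–3.

## References
* [Varadarajan1989] V. S. Varadarajan, *An Introduction to Harmonic Analysis on Semisimple Lie Groups*, Cambridge Stud. Adv. Math. 16 (1989), §6.4 Lemma 21, Thm 22.
* [Bouaziz1994IntegralesOrbitales] A. Bouaziz, *Intégrales orbitales sur les algèbres de Lie réductives*, Invent. Math. 115 (1994), §3.1 (I₂) p. 579.
* [Rogawski1990] J. D. Rogawski, *Automorphic Representations of Unitary Groups in Three Variables*, Ann. of Math. Stud. 123 (1990), §8.2 pp. 119–122.
-/

set_option autoImplicit false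

noncomputable section

open MeasureTheory Measure Filter Topology Set Function NumberField NumberField.InfinitePlace Matrix Complex
open Literature.NumberTheory.Automorphic Literature.NumberTheory.Automorphic.UnitaryGroup Literature.NumberTheory.Automorphic.ArchCartan
open scoped ContDiff Classical MatrixGroups Matrix ENNReal NNReal
open scoped Matrix.Norms.Operator

local notation3 "Φ₂[" L "]" => (Matrix.of fun i j : Fin 2 => if i.val + j.val + 1 = 2 then (1 : L) else 0)

namespace Literature.NumberTheory.Automorphic.UnitaryGroup

/-! ## §1 The modulus of the compact normalising factor; the Cayley torus point scales with its centre -/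

/-- `‖1 − e^{ix}‖ = 2 |sin(x/2)|`. [cite: Varadarajan1989, §6.4 Lemma 21] -/
theorem norm_one_sub_coe_circleExp (x : ℝ) : ‖(1 : ℂ) - (Circle.exp x : ℂ)‖ = 2 * |Real.sin (x / 2)| := by
  rw [Circle.coe_exp, norm_sub_rev, mul_comm ((x : ℝ) : ℂ) I, Complex.norm_exp_I_mul_ofReal_sub_one, Real.norm_eq_abs, abs_mul, abs_two]

/-! ## §2 THE WALL PLACE: `2|sin ψ| · ν_w{g : g · P t_u(ψ) P⁻¹ · g⁻¹ ∈ C} ≤ B` for `0 < |ψ| < δ`, uniformly in `u ∈ S¹` (the one-place engine at order `0`, one bump) -/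

section Wall

variable (L : Type) [Field L] [NumberField L] (w : {w : InfinitePlace L // IsComplex w})

/-- The Cayley torus point scales with its centre: `P t_u(ψ) P⁻¹ = u · P t_1(ψ) P⁻¹` as matrices. [cite: Rogawski1990, §8.2 p. 122] -/
theorem coe_cayleyTorus_eq_smul (u : Circle) (ψ : ℝ) :
    ((Matrix.GeneralLinearGroup.mkOfDetNeZero !![(1 : ℂ), 1; 1, -1] det_cayleyTwo_ne_zero * circleDiagonal 2 ![u * Circle.exp ψ, u * Circle.exp (-ψ)] *
          (Matrix.GeneralLinearGroup.mkOfDetNeZero !![(1 : ℂ), 1; 1, -1] det_cayleyTwo_ne_zero)⁻¹ : GL (Fin 2) ℂ) : Matrix (Fin 2) (Fin 2) ℂ) =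
      (u : ℂ) • ((Matrix.GeneralLinearGroup.mkOfDetNeZero !![(1 : ℂ), 1; 1, -1] det_cayleyTwo_ne_zero * circleDiagonal 2 ![1 * Circle.exp ψ, 1 * Circle.exp (-ψ)] *
          (Matrix.GeneralLinearGroup.mkOfDetNeZero !![(1 : ℂ), 1; 1, -1] det_cayleyTwo_ne_zero)⁻¹ : GL (Fin 2) ℂ) : Matrix (Fin 2) (Fin 2) ℂ) := by
  have hd : (Matrix.diagonal fun i => ((![u * Circle.exp ψ, u * Circle.exp (-ψ)] i : Circle) : ℂ)) =
      (u : ℂ) • Matrix.diagonal fun i => ((![1 * Circle.exp ψ, 1 * Circle.exp (-ψ)] i : Circle) : ℂ) := by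
    rw [← Matrix.diagonal_smul]
    congr 1
    funext i
    fin_cases i <;> simp [Circle.coe_mul]
  rw [Units.val_mul, Units.val_mul, Units.val_mul, Units.val_mul, coe_circleDiagonal, coe_circleDiagonal, hd, Matrix.mul_smul, Matrix.smul_mul]

/-- Conjugation commutes with a scalar factor: if `X = u · Y` as matrices then `g X g⁻¹ = u · g Y g⁻¹`. [cite: Rogawski1990, §8.2 p. 122] -/
theorem coe_conj_eq_smul_of_coe_eq_smul {g X Y : GL (Fin 2) ℂ} {u : ℂ} (h : (X : Matrix (Fin 2) (Fin 2) ℂ) = u • (Y : Matrix (Fin 2) (Fin 2) ℂ)) :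
    ((g * X * g⁻¹ : GL (Fin 2) ℂ) : Matrix (Fin 2) (Fin 2) ℂ) = u • ((g * Y * g⁻¹ : GL (Fin 2) ℂ) : Matrix (Fin 2) (Fin 2) ℂ) := by
  rw [Units.val_mul, Units.val_mul, Units.val_mul, Units.val_mul, h, Matrix.mul_smul, Matrix.smul_mul]

variable [MeasurableSpace ↥(archLocal L 2 Φ₂[L] w)] [BorelSpace ↥(archLocal L 2 Φ₂[L] w)]
  (ν : Measure ↥(archLocal L 2 Φ₂[L] w)) [ν.IsHaarMeasure] [ν.IsMulRightInvariant]

/-- **HARISH-CHANDRA'S BOUNDEDNESS OF THE NORMALISED ELLIPTIC ORBITAL VOLUME, CAYLEY FRAME, UNIFORM IN THE CENTRE.**  For a compact `C ⊆ U(Φ₂)_w` there are `δ > 0` and `B` with, for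
every `u ∈ S¹` and `0 < |ψ| < δ`: the conjugating set `{g : g · P t_u(ψ) P⁻¹ · g⁻¹ ∈ C}` has finite Haar measure and `2|sin ψ| · ν{g : g · P t_u(ψ) P⁻¹ · g⁻¹ ∈ C} ≤ B`
(`t_u(ψ) = diag(u e^{iψ}, u e^{−iψ})`).  One bump `f₊ ≥ 0`, `= 1` on `S¹ · C ⊆ M₂(ℂ)`, dominates all the indicators (`t_u = u · t_1`), and ★ (α2)
`exists_forall_eventually_norm_iteratedDeriv_orbitalIntegral_cayley_le` at order `0`, centre `1`, bounds `2 sin ψ · ∫ f₊(↑↑(g · P t_1(ψ) P⁻¹ · g⁻¹)) dν`.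
[cite: Varadarajan1989, §6.4 Thm 22] [cite: Bouaziz1994IntegralesOrbitales, §3.1 (I₂) p. 579] [cite: Rogawski1990, §8.2 p. 122] -/
theorem exists_two_mul_abs_sin_mul_measure_conj_mem_le (C : Set ↥(archLocal L 2 Φ₂[L] w)) (hC : IsCompact C) :
    ∃ δ > (0 : ℝ), ∃ B : ℝ, ∀ (u : Circle) (ψ : ℝ), ψ ≠ 0 → |ψ| < δ →
      ν {g : ↥(archLocal L 2 Φ₂[L] w) | g * ⟨Matrix.GeneralLinearGroup.mkOfDetNeZero !![(1 : ℂ), 1; 1, -1] det_cayleyTwo_ne_zero *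
            circleDiagonal 2 ![u * Circle.exp ψ, u * Circle.exp (-ψ)] * (Matrix.GeneralLinearGroup.mkOfDetNeZero !![(1 : ℂ), 1; 1, -1] det_cayleyTwo_ne_zero)⁻¹,
            cayley_conj_circleDiagonal_mem_archLocal L w _⟩ * g⁻¹ ∈ C} < ⊤ ∧
      2 * |Real.sin ψ| * (ν {g : ↥(archLocal L 2 Φ₂[L] w) | g * ⟨Matrix.GeneralLinearGroup.mkOfDetNeZero !![(1 : ℂ), 1; 1, -1] det_cayleyTwo_ne_zero *
            circleDiagonal 2 ![u * Circle.exp ψ, u * Circle.exp (-ψ)] * (Matrix.GeneralLinearGroup.mkOfDetNeZero !![(1 : ℂ), 1; 1, -1] det_cayleyTwo_ne_zero)⁻¹,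
            cayley_conj_circleDiagonal_mem_archLocal L w _⟩ * g⁻¹ ∈ C}).toReal ≤ B := by
  haveI : LocallyCompactSpace ↥(archLocal L 2 Φ₂[L] w) := locallyCompactSpace_archLocal L 2 Φ₂[L] w
  haveI : SecondCountableTopology ↥(archLocal L 2 Φ₂[L] w) := secondCountableTopology_archLocal L 2 Φ₂[L] w
  -- notation: the Cayley torus point with centre `u`
  let T : Circle → ℝ → ↥(archLocal L 2 Φ₂[L] w) := fun u ψ =>
    ⟨Matrix.GeneralLinearGroup.mkOfDetNeZero !![(1 : ℂ), 1; 1, -1] det_cayleyTwo_ne_zero * circleDiagonal 2 ![u * Circle.exp ψ, u * Circle.exp (-ψ)] *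
        (Matrix.GeneralLinearGroup.mkOfDetNeZero !![(1 : ℂ), 1; 1, -1] det_cayleyTwo_ne_zero)⁻¹, cayley_conj_circleDiagonal_mem_archLocal L w _⟩
  -- `U(Φ₂)_w ↪ M₂(ℂ)` is a closed embedding
  have hce : IsClosedEmbedding (fun g : ↥(archLocal L 2 Φ₂[L] w) => ((g : GL (Fin 2) ℂ) : Matrix (Fin 2) (Fin 2) ℂ)) :=
    isClosedEmbedding_coe_unitaryGroupOfForm_of_eq_over (by rw [Literature.NumberTheory.Rogawski1990.antidiagOne_map, StdForm.over_antidiagonal_eq])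
  -- the circle-saturation of `C` in `M₂(ℂ)`, a ball containing it, one bump equal to `1` on it
  set MC : Set (Matrix (Fin 2) (Fin 2) ℂ) := (fun p : Circle × ↥(archLocal L 2 Φ₂[L] w) => p.1 • ((p.2 : GL (Fin 2) ℂ) : Matrix (Fin 2) (Fin 2) ℂ)) '' (univ ×ˢ C)
    with hMC_def
  have hMC : IsCompact MC := ((isCompact_univ (X := Circle)).prod hC).image (continuous_fst.smul (hce.continuous.comp continuous_snd))
  obtain ⟨R, hR⟩ := hMC.isBounded.subset_closedBall 0
  let b : ContDiffBump (0 : Matrix (Fin 2) (Fin 2) ℂ) := ⟨max R 1, max R 1 + 1, lt_max_of_lt_right one_pos, lt_add_one _⟩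
  have hb1 : ∀ X ∈ MC, b X = 1 := fun X hX => b.one_of_mem_closedBall (Metric.closedBall_subset_closedBall (le_max_left R 1) (hR hX))
  -- the engine at order `0`, centre `1`
  obtain ⟨B, hB⟩ := exists_forall_eventually_norm_iteratedDeriv_orbitalIntegral_cayley_le (E := ℝ) L w ν
    (fun f ψ => (2 * Real.sin ψ) • ∫ h : ↥(archLocal L 2 Φ₂[L] w), f (((h * T 1 ψ * h⁻¹ : ↥(archLocal L 2 Φ₂[L] w)) : GL (Fin 2) ℂ) : Matrix (Fin 2) (Fin 2) ℂ) ∂ν)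
    1 (fun _ _ => rfl) b.contDiff b.hasCompactSupport 0
  simp only [iteratedDeriv_zero] at hB
  obtain ⟨δ, hδ, hδB⟩ := Metric.eventually_nhds_iff.1 (eventually_nhdsWithin_iff.1 hB)
  refine ⟨min δ Real.pi, lt_min hδ Real.pi_pos, B, fun u ψ hψ0 hψδ => ?_⟩
  have hψδ' : |ψ| < δ := hψδ.trans_le (min_le_left _ _)
  have hψπ : |ψ| < Real.pi := hψδ.trans_le (min_le_right _ _)
  have hFB : ‖(2 * Real.sin ψ) • ∫ h : ↥(archLocal L 2 Φ₂[L] w), b (((h * T 1 ψ * h⁻¹ : ↥(archLocal L 2 Φ₂[L] w)) : GL (Fin 2) ℂ) : Matrix (Fin 2) (Fin 2) ℂ) ∂ν‖ ≤ B :=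
    hδB (by rwa [Real.dist_eq, sub_zero]) hψ0
  -- the test point `T 1 ψ` is a REGULAR compact chart point (`0 < |ψ| < π`): compact conjugating sets
  have hT1 : T 1 ψ = endoBlock L ∅ (fun _ => ![ψ, 0, -ψ]) w := by
    apply Subtype.ext
    show (Matrix.GeneralLinearGroup.mkOfDetNeZero !![(1 : ℂ), 1; 1, -1] det_cayleyTwo_ne_zero * circleDiagonal 2 ![1 * Circle.exp ψ, 1 * Circle.exp (-ψ)] *
        (Matrix.GeneralLinearGroup.mkOfDetNeZero !![(1 : ℂ), 1; 1, -1] det_cayleyTwo_ne_zero)⁻¹ : GL (Fin 2) ℂ) = (endoBlock L ∅ (fun _ => ![ψ, 0, -ψ]) w : GL (Fin 2) ℂ)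
    unfold endoBlock
    rw [if_neg (Finset.notMem_empty w)]
    simp only [one_mul, Matrix.cons_val_zero]
    rfl
  have hreg : ∀ c ∈ ({fun _ => ![ψ, 0, -ψ]} : Set ({w : InfinitePlace L // IsComplex w} → Fin 3 → ℝ)), Circle.exp (c w 0) ≠ Circle.exp (c w 2) := by
    intro c hc h
    rw [mem_singleton_iff.1 hc] at h
    simp only [Matrix.cons_val_zero, Matrix.cons_val_two, Matrix.tail_cons, Matrix.head_cons] at h
    obtain ⟨m, hm⟩ := Circle.exp_eq_exp.1 h
    have hψm : ψ = (m : ℝ) * Real.pi := by linarith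
    have hm1 : |(m : ℝ)| < 1 := by
      have h1 : |(m : ℝ)| * Real.pi < 1 * Real.pi := by
        calc |(m : ℝ)| * Real.pi = |(m : ℝ) * Real.pi| := by rw [abs_mul, abs_of_pos Real.pi_pos]
          _ = |ψ| := by rw [← hψm]
          _ < 1 * Real.pi := by rw [one_mul]; exact hψπ
      exact lt_of_mul_lt_mul_right h1 Real.pi_pos.le
    have hm0 : m = 0 := by
      have : |m| < 1 := by exact_mod_cast hm1
      exact Int.abs_lt_one_iff.1 this
    rw [hm0, Int.cast_zero, zero_mul] at hψm
    exact hψ0 hψm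
  have hC'' : IsCompact ((fun g : ↥(archLocal L 2 Φ₂[L] w) => ((g : GL (Fin 2) ℂ) : Matrix (Fin 2) (Fin 2) ℂ)) ⁻¹' tsupport b) :=
    hce.isCompact_preimage b.hasCompactSupport
  have hKC : IsCompact {y : ↥(archLocal L 2 Φ₂[L] w) | ∃ c ∈ ({fun _ => ![ψ, 0, -ψ]} : Set ({w : InfinitePlace L // IsComplex w} → Fin 3 → ℝ)),
      y * endoBlock L ∅ c w * y⁻¹ ∈ (fun g : ↥(archLocal L 2 Φ₂[L] w) => ((g : GL (Fin 2) ℂ) : Matrix (Fin 2) (Fin 2) ℂ)) ⁻¹' tsupport b} :=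
    isCompact_setOf_exists_conj_endoBlock_mem_of_not_mem L w ∅ (Finset.notMem_empty w) isCompact_singleton hreg hC''
  -- the integrand `g ↦ f₊(↑↑(g T_1(ψ) g⁻¹))`: continuous, supported in the compact conjugating set, integrable
  have hconj_c : Continuous fun g : ↥(archLocal L 2 Φ₂[L] w) => (((g * T 1 ψ * g⁻¹ : ↥(archLocal L 2 Φ₂[L] w)) : GL (Fin 2) ℂ) : Matrix (Fin 2) (Fin 2) ℂ) :=
    hce.continuous.comp ((continuous_id.mul continuous_const).mul continuous_id.inv)
  have hint : Integrable (fun g : ↥(archLocal L 2 Φ₂[L] w) => b (((g * T 1 ψ * g⁻¹ : ↥(archLocal L 2 Φ₂[L] w)) : GL (Fin 2) ℂ) : Matrix (Fin 2) (Fin 2) ℂ)) ν := by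
    refine (b.continuous.comp hconj_c).integrable_of_hasCompactSupport (HasCompactSupport.intro hKC fun g hg => ?_)
    have hg' : ¬ (((g * T 1 ψ * g⁻¹ : ↥(archLocal L 2 Φ₂[L] w)) : GL (Fin 2) ℂ) : Matrix (Fin 2) (Fin 2) ℂ) ∈ tsupport b := by
      intro h
      exact hg ⟨fun _ => ![ψ, 0, -ψ], mem_singleton _, by rw [← hT1]; exact h⟩
    exact image_eq_zero_of_notMem_tsupport (f := (b : Matrix (Fin 2) (Fin 2) ℂ → ℝ)) hg'
  -- the saturated conjugating set `Â ⊇ A_u`, closed, inside the compact conjugating set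
  set Ah : Set ↥(archLocal L 2 Φ₂[L] w) := {g | (((g * T 1 ψ * g⁻¹ : ↥(archLocal L 2 Φ₂[L] w)) : GL (Fin 2) ℂ) : Matrix (Fin 2) (Fin 2) ℂ) ∈ MC} with hAh_def
  have hAh_meas : MeasurableSet Ah := (hMC.isClosed.preimage hconj_c).measurableSet
  have hAsub : {g : ↥(archLocal L 2 Φ₂[L] w) | g * T u ψ * g⁻¹ ∈ C} ⊆ Ah := by
    intro g hg
    refine ⟨(u⁻¹, g * T u ψ * g⁻¹), ⟨mem_univ _, hg⟩, ?_⟩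
    show (u⁻¹ : Circle) • (((g * T u ψ * g⁻¹ : ↥(archLocal L 2 Φ₂[L] w)) : GL (Fin 2) ℂ) : Matrix (Fin 2) (Fin 2) ℂ) =
      (((g * T 1 ψ * g⁻¹ : ↥(archLocal L 2 Φ₂[L] w)) : GL (Fin 2) ℂ) : Matrix (Fin 2) (Fin 2) ℂ)
    have h1 : (((g * T u ψ * g⁻¹ : ↥(archLocal L 2 Φ₂[L] w)) : GL (Fin 2) ℂ) : Matrix (Fin 2) (Fin 2) ℂ) =
        (u : ℂ) • (((g * T 1 ψ * g⁻¹ : ↥(archLocal L 2 Φ₂[L] w)) : GL (Fin 2) ℂ) : Matrix (Fin 2) (Fin 2) ℂ) := by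
      show (((g : GL (Fin 2) ℂ) * (Matrix.GeneralLinearGroup.mkOfDetNeZero !![(1 : ℂ), 1; 1, -1] det_cayleyTwo_ne_zero *
            circleDiagonal 2 ![u * Circle.exp ψ, u * Circle.exp (-ψ)] * (Matrix.GeneralLinearGroup.mkOfDetNeZero !![(1 : ℂ), 1; 1, -1] det_cayleyTwo_ne_zero)⁻¹) *
            (g : GL (Fin 2) ℂ)⁻¹ : GL (Fin 2) ℂ) : Matrix (Fin 2) (Fin 2) ℂ) =
        (u : ℂ) • (((g : GL (Fin 2) ℂ) * (Matrix.GeneralLinearGroup.mkOfDetNeZero !![(1 : ℂ), 1; 1, -1] det_cayleyTwo_ne_zero *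
            circleDiagonal 2 ![1 * Circle.exp ψ, 1 * Circle.exp (-ψ)] * (Matrix.GeneralLinearGroup.mkOfDetNeZero !![(1 : ℂ), 1; 1, -1] det_cayleyTwo_ne_zero)⁻¹) *
            (g : GL (Fin 2) ℂ)⁻¹ : GL (Fin 2) ℂ) : Matrix (Fin 2) (Fin 2) ℂ)
      exact coe_conj_eq_smul_of_coe_eq_smul (coe_cayleyTorus_eq_smul u ψ)
    rw [h1, Circle.smul_def, smul_smul, Circle.coe_inv, inv_mul_cancel₀ (Circle.coe_ne_zero u), one_smul]
  have hAhK : Ah ⊆ {y : ↥(archLocal L 2 Φ₂[L] w) | ∃ c ∈ ({fun _ => ![ψ, 0, -ψ]} : Set ({w : InfinitePlace L // IsComplex w} → Fin 3 → ℝ)),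
      y * endoBlock L ∅ c w * y⁻¹ ∈ (fun g : ↥(archLocal L 2 Φ₂[L] w) => ((g : GL (Fin 2) ℂ) : Matrix (Fin 2) (Fin 2) ℂ)) ⁻¹' tsupport b} := by
    intro g hg
    refine ⟨fun _ => ![ψ, 0, -ψ], mem_singleton _, ?_⟩
    rw [← hT1]
    show (((g * T 1 ψ * g⁻¹ : ↥(archLocal L 2 Φ₂[L] w)) : GL (Fin 2) ℂ) : Matrix (Fin 2) (Fin 2) ℂ) ∈ tsupport b
    exact subset_tsupport _ (by rw [Function.mem_support, hb1 _ hg]; exact one_ne_zero)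
  have hAh_fin : ν Ah < ⊤ := (measure_mono hAhK).trans_lt hKC.measure_lt_top
  refine ⟨(measure_mono hAsub).trans_lt hAh_fin, ?_⟩
  -- `2|sin ψ| · ν(A_u) ≤ 2|sin ψ| · ν(Â) ≤ 2|sin ψ| · ∫ f₊ ≤ ‖F f₊ ψ‖ ≤ B`
  have h1 : (ν {g : ↥(archLocal L 2 Φ₂[L] w) | g * T u ψ * g⁻¹ ∈ C}).toReal ≤ (ν Ah).toReal := ENNReal.toReal_mono hAh_fin.ne (measure_mono hAsub)
  have h2 : (ν Ah).toReal ≤ ∫ g : ↥(archLocal L 2 Φ₂[L] w), b (((g * T 1 ψ * g⁻¹ : ↥(archLocal L 2 Φ₂[L] w)) : GL (Fin 2) ℂ) : Matrix (Fin 2) (Fin 2) ℂ) ∂ν := by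
    rw [← measureReal_def, ← integral_indicator_one hAh_meas]
    refine integral_mono_of_nonneg (Eventually.of_forall fun g => Set.indicator_nonneg (fun _ _ => zero_le_one) g) hint (Eventually.of_forall ?_)
    refine Set.indicator_le' (fun g hg => ?_) fun g _ => b.nonneg
    show (1 : ℝ) ≤ _
    rw [hb1 _ hg]
  have h3 : 0 ≤ ∫ g : ↥(archLocal L 2 Φ₂[L] w), b (((g * T 1 ψ * g⁻¹ : ↥(archLocal L 2 Φ₂[L] w)) : GL (Fin 2) ℂ) : Matrix (Fin 2) (Fin 2) ℂ) ∂ν :=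
    integral_nonneg fun g => b.nonneg
  rw [norm_smul, Real.norm_eq_abs, Real.norm_eq_abs, abs_mul, abs_two] at hFB
  calc 2 * |Real.sin ψ| * (ν {g : ↥(archLocal L 2 Φ₂[L] w) | g * T u ψ * g⁻¹ ∈ C}).toReal
      ≤ 2 * |Real.sin ψ| * ∫ g : ↥(archLocal L 2 Φ₂[L] w), b (((g * T 1 ψ * g⁻¹ : ↥(archLocal L 2 Φ₂[L] w)) : GL (Fin 2) ℂ) : Matrix (Fin 2) (Fin 2) ℂ) ∂ν :=
        mul_le_mul_of_nonneg_left (h1.trans h2) (by positivity)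
    _ ≤ 2 * |Real.sin ψ| * |∫ g : ↥(archLocal L 2 Φ₂[L] w), b (((g * T 1 ψ * g⁻¹ : ↥(archLocal L 2 Φ₂[L] w)) : GL (Fin 2) ℂ) : Matrix (Fin 2) (Fin 2) ℂ) ∂ν| :=
        mul_le_mul_of_nonneg_left (le_abs_self _) (by positivity)
    _ ≤ B := hFB

end Wall

/-! ## §3 The wall place in coordinates -/

section WallCoord

variable (L : Type) [Field L] [NumberField L] (S : Finset {w : InfinitePlace L // IsComplex w}) (w : {w : InfinitePlace L // IsComplex w})
  [MeasurableSpace ↥(archLocal L 2 Φ₂[L] w)] [BorelSpace ↥(archLocal L 2 Φ₂[L] w)]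
  (ν : Measure ↥(archLocal L 2 Φ₂[L] w)) [ν.IsHaarMeasure] [ν.IsMulRightInvariant]

/-- **THE WALL PLACE IN COORDINATES**: at a compact place `w ∉ S` and a base point `c₀` ON the wall (`e^{ic₀w0} = e^{ic₀w2}`), for a compact `C ⊆ U(Φ₂)_w` there are `U ∈ 𝓝 c₀` and `B`
with, for every `c ∈ U` regular at `w`: `ν{g : g γ_w(c) g⁻¹ ∈ C} < ∞` and `‖1 − e^{i(c_w2 − c_w0)}‖ · ν{g : g γ_w(c) g⁻¹ ∈ C} ≤ B` (`γ_w(c) = endoBlock L S c w`) — §3 at `ψ = (c_w0 − c_w2)/2 − mπ`, centre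
`u = e^{i((c_w0 + c_w2)/2 + mπ)}` (`γ_w(c_w) = P t_u(ψ) P⁻¹`, `‖1 − e^{i(c_w2−c_w0)}‖ = 2|sin ψ|`). [cite: Varadarajan1989, §6.4 Thm 22] [cite: Bouaziz1994IntegralesOrbitales, §3.1 (I₂) p. 579]
[cite: Rogawski1990, §8.2 p. 122] -/
theorem exists_nhds_norm_mul_measure_conj_endoBlock_mem_le (hwS : w ∉ S) (C : Set ↥(archLocal L 2 Φ₂[L] w)) (hC : IsCompact C)
    (c₀ : {w : InfinitePlace L // IsComplex w} → Fin 3 → ℝ) (h0 : Circle.exp (c₀ w 0) = Circle.exp (c₀ w 2)) :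
    ∃ U ∈ 𝓝 c₀, ∃ B : ℝ, ∀ c ∈ U, Circle.exp (c w 0) ≠ Circle.exp (c w 2) →
      ν {g : ↥(archLocal L 2 Φ₂[L] w) | g * endoBlock L S c w * g⁻¹ ∈ C} < ⊤ ∧
      ‖(1 : ℂ) - (Circle.exp (c w 2 - c w 0) : ℂ)‖ * (ν {g : ↥(archLocal L 2 Φ₂[L] w) | g * endoBlock L S c w * g⁻¹ ∈ C}).toReal ≤ B := by
  obtain ⟨δ, hδ, B, hB⟩ := exists_two_mul_abs_sin_mul_measure_conj_mem_le L w ν C hC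
  obtain ⟨m, hm⟩ := Circle.exp_eq_exp.1 h0
  have hψc : Continuous fun c : {w : InfinitePlace L // IsComplex w} → Fin 3 → ℝ => (c w 0 - c w 2) / 2 - m * Real.pi := by fun_prop
  refine ⟨{c | |(c w 0 - c w 2) / 2 - m * Real.pi| < δ}, (isOpen_lt (continuous_abs.comp hψc) continuous_const).mem_nhds ?_, B, fun c hcU hreg => ?_⟩
  · show |(c₀ w 0 - c₀ w 2) / 2 - m * Real.pi| < δ
    rw [hm, show (c₀ w 2 + m * (2 * Real.pi) - c₀ w 2) / 2 - m * Real.pi = 0 by ring, abs_zero]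
    exact hδ
  -- at `c`: `ψ`, the centre `u`, the chart point `γ_w(c_w) = P t_u(ψ) P⁻¹`, `ψ ≠ 0`
  have hψδ : |(c w 0 - c w 2) / 2 - m * Real.pi| < δ := hcU
  have h1 : Circle.exp ((c w 0 + c w 2) / 2 + m * Real.pi) * Circle.exp ((c w 0 - c w 2) / 2 - m * Real.pi) = Circle.exp (c w 0) := by
    rw [← Circle.exp_add]; congr 1; ring
  have h2 : Circle.exp ((c w 0 + c w 2) / 2 + m * Real.pi) * Circle.exp (-((c w 0 - c w 2) / 2 - m * Real.pi)) = Circle.exp (c w 2) := by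
    rw [← Circle.exp_add, show (c w 0 + c w 2) / 2 + m * Real.pi + -((c w 0 - c w 2) / 2 - m * Real.pi) = c w 2 + m * (2 * Real.pi) by ring,
      Circle.exp_add, Circle.exp_int_mul_two_pi, mul_one]
  have hγ : endoBlock L S c w = ⟨Matrix.GeneralLinearGroup.mkOfDetNeZero !![(1 : ℂ), 1; 1, -1] det_cayleyTwo_ne_zero *
      circleDiagonal 2 ![Circle.exp ((c w 0 + c w 2) / 2 + m * Real.pi) * Circle.exp ((c w 0 - c w 2) / 2 - m * Real.pi),
        Circle.exp ((c w 0 + c w 2) / 2 + m * Real.pi) * Circle.exp (-((c w 0 - c w 2) / 2 - m * Real.pi))] *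
      (Matrix.GeneralLinearGroup.mkOfDetNeZero !![(1 : ℂ), 1; 1, -1] det_cayleyTwo_ne_zero)⁻¹, cayley_conj_circleDiagonal_mem_archLocal L w _⟩ := by
    rw [h1, h2]
    unfold endoBlock
    rw [if_neg hwS]
  have hψ0 : (c w 0 - c w 2) / 2 - m * Real.pi ≠ 0 := by
    intro h
    apply hreg
    rw [show c w 0 = c w 2 + m * (2 * Real.pi) by linarith, Circle.exp_add, Circle.exp_int_mul_two_pi, mul_one]
  have hE : ‖(1 : ℂ) - (Circle.exp (c w 2 - c w 0) : ℂ)‖ = 2 * |Real.sin ((c w 0 - c w 2) / 2 - m * Real.pi)| := by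
    rw [norm_one_sub_coe_circleExp,
      show (c w 2 - c w 0) / 2 = -((c w 0 - c w 2) / 2 - m * Real.pi + m * Real.pi) by ring, Real.sin_neg, abs_neg, Real.sin_add_int_mul_pi, abs_mul,
      abs_neg_one_zpow, one_mul]
  rw [hγ, hE]
  exact hB (Circle.exp ((c w 0 + c w 2) / 2 + m * Real.pi)) _ hψ0 hψδ

end WallCoord

end Literature.NumberTheory.Automorphic.UnitaryGroup

end
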